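import Literature.NumberTheory.PAdicHodge.AinfRamifiedEtaPeriod
import Literature.NumberTheory.PAdicHodge.AinfRamifiedTateModule
import HarnessLib

/-!
# Fontaine's element of a `p`-power DIVISION sequence and its Kummer cocycle, over the ramified base `𝒪_D = ℤ_p[ϖ]`

Topic `Literature/NumberTheory/PAdicHodge`; namespace `Literature.NumberTheory.PAdicHodge.AinfRamTop`. The ramified twin
(`A_inf(𝒪) = 𝔸_inf(F)[ϖ]`, `W` over `CoeffDisc D`, Tate module `TatePtO F (W ⊗_ψ 𝒪_F) p`) of `AinfWeierstrassDivisionLift`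
(first floor of brick (K1) of the hT₂ programme of crux K★ `stmt-BirchSwinnertonDyer-22226`,
`Summits/…/Cruxes/StarredOptimalManinUnitFiveSeven/Lines/kato-lever-hT2-programme.md` §4): for a `[p]_W`-DIVISION sequence `u = (uₙ)`
of points of `Ŵ(𝔪_{ℂ_F})` (`mulPC W (u (n+1)) = u n`, `u₀` arbitrary):

* §1 the group `Ŵ(𝔫_𝒪)` (`𝔫_𝒪 = θ_𝒪⁻¹(𝔪_{ℂ_F}) ⊂ A_inf(𝒪)`): `σ` as a group endomorphism `galPtN` (through the tree's `galAlgHom`),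
  `p • P = mulP W P`, `P + Q = addW W P Q`;
* §2 **Fontaine's integral `divisionLiftPt W hθ u ∈ Ŵ(𝔫_𝒪)`** (the tree's `torsionLift`, which never used `u₀ = 0`): `θ_𝒪([ũ]) = u₀`,
  `σ[ũ] = [σu]`, `[u ⊕ u'] = [ũ] + [ũ']`, `[0] = 0`, `[⊖u] = −[ũ]`;
* §3 for a bridge `ψ : 𝒪_D → 𝒪_F` compatible with `𝒪_D → F` and `W♭ = W ⊗_ψ 𝒪_F`: the **Kummer torsion sequence**
  `kummerSeqO W ψ σ u := ((σ • ⟨uₙ⟩) − ⟨uₙ⟩ : Ŵ♭(𝔪_{ℂ_F}))ₙ` (group law of `W♭` read over `𝒪_F`, `[p]`-compatible for `mulPC W`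
  by `val_p_nsmul_map_ψ` / `val_add_map_ψ`), **`(σ − 1)[ũ] = [κ_u(σ)]`** (`divisionLiftPt_kummerSeqO`), and the **Kummer cocycle**
  `kummerCocycleO : Γ_F → TatePtO F W♭ p` (`AinfTop.ofSeqO`) with its cocycle law and `torsionLiftO (κ_u σ) = (σ[ũ] − [ũ]).val`.

What is NOT here: the `(p, ω)`/`(p, ξ)`-adic evaluation of `log_W` at `ι_𝒪[ũ] ∉ Fil¹` (open floor of K1). Definitions (reviewed):
`galPtN`, `divisionLiftPt`, `kummerSeqO`, `kummerCocycleO`. BSD / K★ are not proved by any of this.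

## References
* J.-M. Fontaine, *Le corps des périodes p-adiques*, Astérisque 223 (1994), Exp. II §1.2.2. [FontaineAsterisque223III]
* S. Bloch, K. Kato (1990), Ex. 3.10.1, (3.11.1). [BlochKato1990]
* K. Kato, LNM 1553 (1993), Ch. II Lemma 1.4.3. [Kato1993LNM1553]
* J. H. Silverman, *AEC* (2009), IV.2.3, VIII.§2. [SilvermanAEC2009]
-/

noncomputable section

open Ideal Filter Topology Field WittVector MvPowerSeries ValuativeRel

namespace Literature.NumberTheory.PAdicHodge

open Literature.NumberTheory.GaloisRepresentations
open Literature.NumberTheory.GaloisRepresentations.IsNonarchimedeanLocalField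
open Literature.NumberTheory.GaloisRepresentations.LubinTate
open Literature.NumberTheory.EllipticCurves

namespace AinfRamTop

variable {F : Type} [Field F] [ValuativeRel F] [TopologicalSpace F] [IsNonarchimedeanLocalField F] [CharZero F]
  {p : ℕ} [Fact p.Prime] [Fact (¬ IsUnit (p : integerC F))] [IsAdicComplete (Ideal.span {(p : integerC F)}) (integerC F)]
  {hp : valuation F p < 1} {D : EisensteinRoot F p hp} {hθ : Function.Surjective (fontaineTheta (integerC F) p)}
  (W : WeierstrassCurve (EisensteinRoot.CoeffDisc D))

/-! ## §1 The group `Ŵ(𝔫_𝒪)` -/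

/-- **`σ : Ŵ(𝔫_𝒪) →+ Ŵ(𝔫_𝒪)`** for `σ ∈ Γ_F` (`σ` is continuous on `A_inf(𝒪)` and fixes `𝒪_D`).
[cite: FontaineAsterisque223III, Exp. II §1.2] -/
def galPtN (hθ : Function.Surjective (fontaineTheta (integerC F) p)) (σ : absoluteGaloisGroup F) :
    W.Pt (nilTheta D hθ) →+ W.Pt (nilTheta D hθ) :=
  WeierstrassCurve.Pt.map W (nilTheta D hθ) (nilTheta D hθ) (galAlgHom σ (EisensteinRoot.gal_algebraMap_coeffDisc D σ))
    (continuous_gal σ) fun _ hx => gal_mem_nilTheta σ hx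

/-- Unfolding `galPtN`. [cite: FontaineAsterisque223III, Exp. II §1.2] -/
@[simp] theorem coe_val_galPtN (σ : absoluteGaloisGroup F) (P : W.Pt (nilTheta D hθ)) :
    ((galPtN W hθ σ P).val : AinfRamTop D) = gal D σ (P.val : AinfRamTop D) := rfl

/-- `p • P = [p]_W(P)` in `Ŵ(𝔫_𝒪)`. [cite: SilvermanAEC2009, IV.2.3] -/
theorem val_p_nsmul_N (P : W.Pt (nilTheta D hθ)) : (p • P).val = mulP W P.val := WeierstrassCurve.Pt.val_nsmul p P

/-- `P + Q = addW P Q` in `Ŵ(𝔫_𝒪)`. [cite: CasselsFrohlichANT1967, Ch. VI §3.2] -/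
theorem val_add_N (P Q : W.Pt (nilTheta D hθ)) : (P + Q).val = addW W P.val Q.val := rfl

/-- `[p]_W(0) = 0` on `Ŵ(𝔫_𝒪)`. [cite: SilvermanAEC2009, IV.2.3] -/
theorem mulP_zero : mulP W (0 : (nilTheta D hθ).toIdeal) = 0 := by
  have h := val_p_nsmul_N W (hθ := hθ) (0 : W.Pt (nilTheta D hθ))
  rw [nsmul_zero] at h
  exact h.symm

omit [Fact (¬ IsUnit (p : integerC F))] [IsAdicComplete (Ideal.span {(p : integerC F)}) (integerC F)] in
/-- `[p]_W(0) = 0` on `Ŵ(𝔪_{ℂ_F})` (`p • O = O` in the group `W.Pt`). [cite: SilvermanAEC2009, IV.2.3] -/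
theorem mulPC_zero : mulPC W (0 : (maxNilIdealC F).toIdeal) = 0 := by
  have h := WeierstrassCurve.Pt.val_nsmul p (0 : W.Pt (maxNilIdealC F))
  rw [nsmul_zero] at h
  exact h.symm

omit [Fact (¬ IsUnit (p : integerC F))] [IsAdicComplete (Ideal.span {(p : integerC F)}) (integerC F)] in
/-- The zero sequence is `[p]_W`-compatible. [cite: SilvermanAEC2009, IV.2.3] -/
theorem mulPC_zeroSeq (n : ℕ) : mulPC W ((0 : ℕ → (maxNilIdealC F).toIdeal) (n + 1)) = (0 : ℕ → (maxNilIdealC F).toIdeal) n :=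
  mulPC_zero W

/-! ## §2 Fontaine's integral `[ũ] ∈ Ŵ(𝔫_𝒪)` of a `[p]_W`-division sequence -/

/-- **Fontaine's element of a `[p]_W`-division sequence `u` as a point of `Ŵ(𝔫_𝒪)`** (`torsionLift`, no `u₀ = 0` needed).
[cite: FontaineAsterisque223III, Exp. II §1.2.2] -/
def divisionLiftPt (hθ : Function.Surjective (fontaineTheta (integerC F) p)) (u : ℕ → (maxNilIdealC F).toIdeal)
    (hup : ∀ n, mulPC W (u (n + 1)) = u n) : W.Pt (nilTheta D hθ) :=
  ⟨⟨torsionLift W hθ u hup, flim_mem_nilTheta _ _⟩⟩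

/-- Unfolding `divisionLiftPt`. [cite: FontaineAsterisque223III, Exp. II §1.2.2] -/
@[simp] theorem coe_val_divisionLiftPt (u : ℕ → (maxNilIdealC F).toIdeal) (hup : ∀ n, mulPC W (u (n + 1)) = u n) :
    ((divisionLiftPt W hθ u hup).val : AinfRamTop D) = torsionLift W hθ u hup := rfl

/-- Congruence in the sequence. [cite: FontaineAsterisque223III, Exp. II §1.2.2] -/
theorem divisionLiftPt_congr {u u' : ℕ → (maxNilIdealC F).toIdeal} (h : u = u')
    (hup : ∀ n, mulPC W (u (n + 1)) = u n) (hup' : ∀ n, mulPC W (u' (n + 1)) = u' n) :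
    divisionLiftPt W hθ u hup = divisionLiftPt W hθ u' hup' := by subst h; rfl

/-- **`θ_𝒪([ũ]) = u₀`.** [cite: FontaineAsterisque223III, Exp. II §1.2.2] -/
theorem theta_divisionLiftPt (u : ℕ → (maxNilIdealC F).toIdeal) (hup : ∀ n, mulPC W (u (n + 1)) = u n) :
    theta D ((divisionLiftPt W hθ u hup).val : AinfRamTop D) = u 0 :=
  theta_torsionLiftShift W (hθ := hθ) hup 0

/-- **`σ[ũ] = [σu]`.** [cite: FontaineAsterisque223III, Exp. II §1.2] -/
theorem galPtN_divisionLiftPt (σ : absoluteGaloisGroup F) (u : ℕ → (maxNilIdealC F).toIdeal)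
    (hup : ∀ n, mulPC W (u (n + 1)) = u n) :
    galPtN W hθ σ (divisionLiftPt W hθ u hup) = divisionLiftPt W hθ (AinfTop.galSeq F σ u) (mulPC_galSeq W hθ σ hup) :=
  WeierstrassCurve.Pt.ext (Subtype.ext (by
    rw [coe_val_galPtN, coe_val_divisionLiftPt, coe_val_divisionLiftPt, gal_torsionLift W σ hup]))

/-- **`[u ⊕_W u'] = [ũ] + [ũ']` in `Ŵ(𝔫_𝒪)`** (`torsionLift_addSeq`). [cite: FontaineAsterisque223III, Exp. II §1.2.2] -/
theorem divisionLiftPt_addSeq {u u' : ℕ → (maxNilIdealC F).toIdeal} (hup : ∀ n, mulPC W (u (n + 1)) = u n)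
    (hup' : ∀ n, mulPC W (u' (n + 1)) = u' n) :
    divisionLiftPt W hθ (addSeq W u u') (mulPC_addSeq W hup hup') = divisionLiftPt W hθ u hup + divisionLiftPt W hθ u' hup' :=
  WeierstrassCurve.Pt.ext (Subtype.ext (by
    rw [val_add_N, coe_val_divisionLiftPt]
    exact torsionLift_addSeq W (hθ := hθ) hup hup'))

/-- **`[0] = 0`** (the approximants `[pⁿ](0)` vanish). [cite: FontaineAsterisque223III, Exp. II §1.2.2] -/
theorem divisionLiftPt_zero (hup : ∀ n, mulPC W ((0 : ℕ → (maxNilIdealC F).toIdeal) (n + 1)) = (0 : ℕ → (maxNilIdealC F).toIdeal) n) :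
    divisionLiftPt W hθ 0 hup = 0 := by
  apply WeierstrassCurve.Pt.ext
  apply Subtype.ext
  rw [coe_val_divisionLiftPt, WeierstrassCurve.Pt.val_zero, ZeroMemClass.coe_zero]
  have hu : ∀ n, theta D ((fun _ : ℕ => (0 : (nilTheta D hθ).toIdeal)) n : AinfRamTop D) =
      (0 : ℕ → (maxNilIdealC F).toIdeal) n := fun n => by
    rw [Pi.zero_apply, ZeroMemClass.coe_zero, ZeroMemClass.coe_zero, map_zero]
  refine (torsionLift_eq_flim W hup hu).trans ?_
  have happ : ∀ n, approx (mulP W) (fun _ : ℕ => (0 : (nilTheta D hθ).toIdeal)) n = 0 := fun n => by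
    rw [approx_def, Function.iterate_fixed (mulP_zero W (hθ := hθ)) n, ZeroMemClass.coe_zero]
  have h := tendsto_approx_flim (isContracting_mulP (hθ := hθ) W) (mulP_lift_sub_mem W hup hu)
  have hfun : approx (mulP W) (fun _ : ℕ => (0 : (nilTheta D hθ).toIdeal)) = fun _ => 0 := funext happ
  rw [hfun] at h
  exact tendsto_nhds_unique h tendsto_const_nhds

/-! ## §3 The Kummer torsion sequence and cocycle on `T_pŴ♭(𝒪_{ℂ_F})`, `W♭ = W ⊗_ψ 𝒪_F` -/

variable (ψ : EisensteinRoot.CoeffDisc D →+* LTCoeff F) {hψ : ∀ c, algebraMap (LTCoeff F) F (ψ c) = EisensteinRoot.CoeffDisc.toF D c}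

omit [Fact (¬ IsUnit (p : integerC F))] [IsAdicComplete (Ideal.span {(p : integerC F)}) (integerC F)] in
/-- The termwise negative in `Ŵ♭(𝔪_{ℂ_F})`. [cite: SilvermanAEC2009, IV.2.3] -/
def negSeqO (u : ℕ → (maxNilIdealC F).toIdeal) (n : ℕ) : (maxNilIdealC F).toIdeal := (-(⟨u n⟩ : (W.map ψ).Pt (maxNilIdealC F))).val

omit [Fact (¬ IsUnit (p : integerC F))] [IsAdicComplete (Ideal.span {(p : integerC F)}) (integerC F)] in
include hψ in
/-- `⊖u` is `[p]_W`-compatible. [cite: SilvermanAEC2009, IV.2.3] -/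
theorem mulPC_negSeqO {u : ℕ → (maxNilIdealC F).toIdeal} (hup : ∀ n, mulPC W (u (n + 1)) = u n) (n : ℕ) :
    mulPC W (negSeqO W ψ u (n + 1)) = negSeqO W ψ u n := by
  have hP : p • (⟨u (n + 1)⟩ : (W.map ψ).Pt (maxNilIdealC F)) = ⟨u n⟩ :=
    WeierstrassCurve.Pt.ext ((val_p_nsmul_map_ψ W ψ hψ _).trans (hup n))
  rw [negSeqO, negSeqO, ← val_p_nsmul_map_ψ W ψ hψ, neg_nsmul, hP]

omit [Fact (¬ IsUnit (p : integerC F))] [IsAdicComplete (Ideal.span {(p : integerC F)}) (integerC F)] in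
include hψ in
/-- `u ⊕ (⊖u) = 0` termwise (`addSeq W` is the group law of `W♭` by `val_add_map_ψ`). [cite: SilvermanAEC2009, IV.2.3] -/
theorem addSeq_negSeqO (u : ℕ → (maxNilIdealC F).toIdeal) : addSeq W u (negSeqO W ψ u) = 0 := by
  funext n
  have h := congrArg WeierstrassCurve.Pt.val (add_neg_cancel (⟨u n⟩ : (W.map ψ).Pt (maxNilIdealC F)))
  rw [val_add_map_ψ W ψ hψ] at h
  exact h

omit [Fact (¬ IsUnit (p : integerC F))] [IsAdicComplete (Ideal.span {(p : integerC F)}) (integerC F)] in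
/-- **The Kummer torsion sequence** of `σ ∈ Γ_F` along `u`: `κ_u(σ)ₙ := σuₙ ⊖ uₙ` computed in the group `Ŵ♭(𝔪_{ℂ_F})`.
[cite: BlochKato1990, Ex. 3.10.1] [cite: SilvermanAEC2009, VIII.§2] -/
def kummerSeqO (σ : absoluteGaloisGroup F) (u : ℕ → (maxNilIdealC F).toIdeal) (n : ℕ) : (maxNilIdealC F).toIdeal :=
  ((σ • (⟨u n⟩ : (W.map ψ).Pt (maxNilIdealC F))) - ⟨u n⟩).val

omit [Fact (¬ IsUnit (p : integerC F))] [IsAdicComplete (Ideal.span {(p : integerC F)}) (integerC F)] in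
include hψ in
/-- `κ_u(σ) = σu ⊕ (⊖u)` termwise, in the `𝒪_D`-currency `addSeq W`. [cite: SilvermanAEC2009, IV.2.3] -/
theorem kummerSeqO_eq_addSeq (σ : absoluteGaloisGroup F) (u : ℕ → (maxNilIdealC F).toIdeal) :
    kummerSeqO W ψ σ u = addSeq W (AinfTop.galSeq F σ u) (negSeqO W ψ u) := by
  funext n
  rw [kummerSeqO, sub_eq_add_neg, val_add_map_ψ W ψ hψ]
  rfl

omit [Fact (¬ IsUnit (p : integerC F))] [IsAdicComplete (Ideal.span {(p : integerC F)}) (integerC F)] in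
include hψ in
/-- **`κ_u(σ)` is `[p]_W`-compatible.** [cite: SilvermanAEC2009, IV.2.3] -/
theorem mulPC_kummerSeqO (σ : absoluteGaloisGroup F) {u : ℕ → (maxNilIdealC F).toIdeal}
    (hup : ∀ n, mulPC W (u (n + 1)) = u n) (n : ℕ) : mulPC W (kummerSeqO W ψ σ u (n + 1)) = kummerSeqO W ψ σ u n := by
  have hP : p • (⟨u (n + 1)⟩ : (W.map ψ).Pt (maxNilIdealC F)) = ⟨u n⟩ :=
    WeierstrassCurve.Pt.ext ((val_p_nsmul_map_ψ W ψ hψ _).trans (hup n))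
  have hσ : σ • (p • (⟨u (n + 1)⟩ : (W.map ψ).Pt (maxNilIdealC F))) = p • (σ • (⟨u (n + 1)⟩ : (W.map ψ).Pt (maxNilIdealC F))) :=
    map_nsmul (DistribSMul.toAddMonoidHom ((W.map ψ).Pt (maxNilIdealC F)) σ) p _
  rw [kummerSeqO, kummerSeqO, ← val_p_nsmul_map_ψ W ψ hψ, nsmul_sub, ← hσ, hP]

omit [Fact (¬ IsUnit (p : integerC F))] [IsAdicComplete (Ideal.span {(p : integerC F)}) (integerC F)] in
/-- **`κ_u(σ)₀ = 0` when `u₀` is fixed by `σ`.** [cite: BlochKato1990, Ex. 3.10.1] -/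
theorem coe_kummerSeqO_zero (σ : absoluteGaloisGroup F) {u : ℕ → (maxNilIdealC F).toIdeal}
    (hu₀ : galCBall σ (u 0 : CBall F) = u 0) : ((kummerSeqO W ψ σ u 0 : (maxNilIdealC F).toIdeal) : CBall F) = 0 := by
  have h : σ • (⟨u 0⟩ : (W.map ψ).Pt (maxNilIdealC F)) = ⟨u 0⟩ := WeierstrassCurve.Pt.ext (Subtype.ext hu₀)
  rw [kummerSeqO, h, sub_self, WeierstrassCurve.Pt.val_zero]
  rfl

/-- **`[⊖u] = −[ũ]`** in `Ŵ(𝔫_𝒪)`. [cite: FontaineAsterisque223III, Exp. II §1.2.2] -/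
theorem divisionLiftPt_negSeqO {u : ℕ → (maxNilIdealC F).toIdeal} (hup : ∀ n, mulPC W (u (n + 1)) = u n)
    (hψ : ∀ c, algebraMap (LTCoeff F) F (ψ c) = EisensteinRoot.CoeffDisc.toF D c) :
    divisionLiftPt W hθ (negSeqO W ψ u) (mulPC_negSeqO W ψ (hψ := hψ) hup) = -divisionLiftPt W hθ u hup := by
  have hsum := divisionLiftPt_addSeq W (hθ := hθ) hup (mulPC_negSeqO W ψ (hψ := hψ) hup)
  have h0 : divisionLiftPt W hθ (addSeq W u (negSeqO W ψ u)) (mulPC_addSeq W hup (mulPC_negSeqO W ψ (hψ := hψ) hup)) = 0 :=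
    (divisionLiftPt_congr W (addSeq_negSeqO W ψ (hψ := hψ) u) _ (mulPC_zeroSeq W)).trans (divisionLiftPt_zero W _)
  rw [h0] at hsum
  exact (neg_eq_of_add_eq_zero_right hsum.symm).symm

/-- **`(σ − 1)[ũ] = [κ_u(σ)]` in `Ŵ(𝔫_𝒪)`.** [cite: FontaineAsterisque223III, Exp. II §1.2.2] [cite: BlochKato1990, Ex. 3.10.1]
[cite: Kato1993LNM1553, Ch. II Lemma 1.4.3] -/
theorem divisionLiftPt_kummerSeqO (σ : absoluteGaloisGroup F) {u : ℕ → (maxNilIdealC F).toIdeal}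
    (hup : ∀ n, mulPC W (u (n + 1)) = u n) (hψ : ∀ c, algebraMap (LTCoeff F) F (ψ c) = EisensteinRoot.CoeffDisc.toF D c) :
    divisionLiftPt W hθ (kummerSeqO W ψ σ u) (mulPC_kummerSeqO W ψ (hψ := hψ) σ hup) =
      galPtN W hθ σ (divisionLiftPt W hθ u hup) - divisionLiftPt W hθ u hup := by
  rw [divisionLiftPt_congr W (kummerSeqO_eq_addSeq W ψ (hψ := hψ) σ u) (mulPC_kummerSeqO W ψ (hψ := hψ) σ hup)
      (mulPC_addSeq W (mulPC_galSeq W hθ σ hup) (mulPC_negSeqO W ψ (hψ := hψ) hup)),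
    divisionLiftPt_addSeq W (mulPC_galSeq W hθ σ hup) (mulPC_negSeqO W ψ (hψ := hψ) hup), divisionLiftPt_negSeqO W ψ hup hψ,
    galPtN_divisionLiftPt, sub_eq_add_neg]

omit [Fact (¬ IsUnit (p : integerC F))] [IsAdicComplete (Ideal.span {(p : integerC F)}) (integerC F)] in
/-- **The Kummer cocycle `σ ↦ κ_u(σ) ∈ TatePtO F W♭ p`** of a `[p]_W`-division sequence `u` with `Γ_F`-fixed `u₀`.
[cite: BlochKato1990, Ex. 3.10.1] [cite: SilvermanAEC2009, VIII.§2] -/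
def kummerCocycleO (hψ : ∀ c, algebraMap (LTCoeff F) F (ψ c) = EisensteinRoot.CoeffDisc.toF D c)
    (u : ℕ → (maxNilIdealC F).toIdeal) (hup : ∀ n, mulPC W (u (n + 1)) = u n)
    (hu₀ : ∀ σ : absoluteGaloisGroup F, galCBall σ (u 0 : CBall F) = u 0) (σ : absoluteGaloisGroup F) :
    AinfTop.TatePtO F (W.map ψ) p :=
  AinfTop.ofSeqO (W.map ψ) (kummerSeqO W ψ σ u) (coe_kummerSeqO_zero W ψ σ (hu₀ σ)) fun n => by
    rw [← AinfTop.val_p_nsmul_O, val_p_nsmul_map_ψ W ψ hψ]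
    exact mulPC_kummerSeqO W ψ (hψ := hψ) σ hup n

variable {u : ℕ → (maxNilIdealC F).toIdeal} {hup : ∀ n, mulPC W (u (n + 1)) = u n}
  {hu₀ : ∀ σ : absoluteGaloisGroup F, galCBall σ (u 0 : CBall F) = u 0}

omit [Fact (¬ IsUnit (p : integerC F))] [IsAdicComplete (Ideal.span {(p : integerC F)}) (integerC F)] in
/-- Components: `κ_u(σ)ₙ = σuₙ − uₙ` in `Ŵ♭(𝔪_{ℂ_F})`. [cite: BlochKato1990, Ex. 3.10.1] -/
theorem proj_kummerCocycleO (σ : absoluteGaloisGroup F) (n : ℕ) :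
    TateModule.proj p n (kummerCocycleO W ψ hψ u hup hu₀ σ) = σ • (⟨u n⟩ : (W.map ψ).Pt (maxNilIdealC F)) - ⟨u n⟩ :=
  WeierstrassCurve.Pt.ext rfl

omit [Fact (¬ IsUnit (p : integerC F))] [IsAdicComplete (Ideal.span {(p : integerC F)}) (integerC F)] in
/-- `seqO (κ_u σ) = kummerSeqO σ u`. [cite: BlochKato1990, Ex. 3.10.1] -/
theorem seqO_kummerCocycleO (σ : absoluteGaloisGroup F) :
    AinfTop.seqO (W.map ψ) (kummerCocycleO W ψ hψ u hup hu₀ σ) = kummerSeqO W ψ σ u := rfl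

omit [Fact (¬ IsUnit (p : integerC F))] [IsAdicComplete (Ideal.span {(p : integerC F)}) (integerC F)] in
/-- **Cocycle law `κ_u(στ) = κ_u(σ) + σ • κ_u(τ)`.** [cite: SilvermanAEC2009, VIII.§2] -/
theorem kummerCocycleO_mul (σ τ : absoluteGaloisGroup F) :
    kummerCocycleO W ψ hψ u hup hu₀ (σ * τ) = kummerCocycleO W ψ hψ u hup hu₀ σ + σ • kummerCocycleO W ψ hψ u hup hu₀ τ :=
  TateModule.ext fun n => by
    rw [map_add, TateModule.proj_smul_of_distribMulAction, proj_kummerCocycleO, proj_kummerCocycleO, proj_kummerCocycleO,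
      mul_smul, smul_sub]
    abel

omit [Fact (¬ IsUnit (p : integerC F))] [IsAdicComplete (Ideal.span {(p : integerC F)}) (integerC F)] in
/-- `κ_u(1) = 0`. [cite: SilvermanAEC2009, VIII.§2] -/
theorem kummerCocycleO_one : kummerCocycleO W ψ hψ u hup hu₀ 1 = 0 :=
  TateModule.ext fun n => by rw [proj_kummerCocycleO, one_smul, sub_self, map_zero]

/-- **`torsionLiftO (κ_u σ) = (σ[ũ] − [ũ]).val`**: Fontaine's element of the Kummer cocycle (read through `seqO`) is the Galois
coboundary of the integral of the division sequence. [cite: FontaineAsterisque223III, Exp. II §1.2.2] [cite: Kato1993LNM1553, Ch. II Lemma 1.4.3] -/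
theorem torsionLiftO_kummerCocycleO (σ : absoluteGaloisGroup F) :
    torsionLiftO W ψ hθ hψ (kummerCocycleO W ψ hψ u hup hu₀ σ) =
      ((galPtN W hθ σ (divisionLiftPt W hθ u hup) - divisionLiftPt W hθ u hup).val : AinfRamTop D) := by
  rw [← divisionLiftPt_kummerSeqO W ψ σ hup hψ, coe_val_divisionLiftPt, torsionLiftO_def]
  rfl

end AinfRamTop

end Literature.NumberTheory.PAdicHodge

end
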